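import Literature.NumberTheory.Transcendental.FischlerRivoalCorollary1Proofs
import Literature.NumberTheory.Transcendental.BinomialAntiEFunctionShift
import Literature.NumberTheory.Transcendental.BorelLaplaceSumLinear
import HarnessLib

/-!
# Fischler–Rivoal's Corollary 1 — reduction, under Conjecture 2, to the non-`E`-ness of one explicit sequence

`Literature/NumberTheory/Transcendental/FischlerRivoalCorollary1Reduction.lean` — everything
PROVED; no definition, no named fact. Second proofs file of the named fact
`FischlerRivoal2024_corollary1` (`FischlerRivoalCorollary1.lean`: Conjecture 2 ⟹
`∫₀^∞ (t+α)^s e^{−t} dt ∉ ℚ̄`). It carries the printed proof [FischlerRivoal2024, §5.2 with §5.1]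
up to the single point where Beukers' method needs André's theorem on `E`-operators:

* `isStrictEFunction_residual_of_conj2` — assume Conjecture 2 (the fact's antecedent, verbatim).
  If the `1`-sum `β` at `z = 1` of `∑ n! C(s,n) cⁿ zⁿ` (`s ∈ ℚ`, `c ∈ ℚ̄`) is algebraic, then
  `g = β − 𝔣(cz)` is an Э-function (`BinomialAntiEFunctionShift.lean`) with `g₀(1) = 0`
  (`BorelLaplaceSumLinear.lean`), Conjecture 2 yields an Э-function `g₁` with `(z − 1)g₁ = g`,
  and reading off coefficients (`coeff_eq_neg_sum_of_X_sub_one_mul`): the residual sequence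
  `rₙ = (∑_{k≤n} k!·C(s,k)cᵏ − β)/n!` IS a strict `E`-coefficient sequence.
* `FischlerRivoal2024_corollary1_of_residual_not_isStrictEFunction` — hence the named fact follows
  from the explicit statement "for real algebraic `α > 0`, `s ∈ ℚ ∖ ℤ_{≥0}`, real algebraic `β`,
  `rₙ = (∑_{k≤n} k!·C(s,k)α^{−k} − β)/n!` is not a strict `E`-sequence" (with
  `FischlerRivoalCorollary1Proofs.lean`: `β = α^{−s}·∫₀^∞(t+α)^s e^{−t}dt` is that `1`-sum, and
  `α^{−s} ∈ ℚ̄`). In the source this statement is the output of Proposition 4 (all solutions of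
  the minimal equation of `g(1/p)` vanish at `p = 1`, impossible for the order-2 inhomogeneous
  equation of `𝔣`, `BinomialAntiEFunctionODE.lean`), whose proof rests on André's structure
  theorem for `E`-operators [Andre2000GevreyI] — NOT in the tree; so the hypothesis stays explicit
  and nothing is discharged here.

## References

* [FischlerRivoal2024] S. Fischler, T. Rivoal, J. Number Theory 261 (2024), §5.1 (Prop. 4),
  §5.2.
* [Andre2000GevreyI] Y. André, *Séries Gevrey de type arithmétique, I*, Ann. of Math. 151 (2000).
-/

noncomputable section

open Complex MeasureTheory Set Filter Real Finset
open scoped Nat Topology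

namespace Literature.NumberTheory.Transcendental

open Literature.Barriers.Schanuel
open Literature.RingTheory.Binomial

variable (s : ℚ) (c β : ℂ)

/-! ### The reduction: under Conjecture 2, an algebraic value forces an explicit sequence to be a strict `E`-sequence -/

/-- Coefficients of the quotient: `(X − 1)·g₁ = f` gives `[zⁿ]g₁ = −∑_{k≤n} [zᵏ]f`. [folklore] -/
theorem coeff_eq_neg_sum_of_X_sub_one_mul {g₁ f : PowerSeries ℂ}
    (h : (PowerSeries.X - 1) * g₁ = f) (n : ℕ) :
    PowerSeries.coeff n g₁ = -∑ k ∈ Finset.range (n + 1), PowerSeries.coeff k f := by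
  induction n with
  | zero =>
    have := congrArg (PowerSeries.coeff 0) h
    rw [sub_mul, one_mul, map_sub, PowerSeries.coeff_zero_X_mul, zero_sub] at this
    rw [Finset.sum_range_one, ← this, neg_neg]
  | succ n ih =>
    have := congrArg (PowerSeries.coeff (n + 1)) h
    rw [sub_mul, one_mul, map_sub, PowerSeries.coeff_succ_X_mul] at this
    rw [Finset.sum_range_succ, ← this, ih]
    ring

/-- Partial sums of the Э-series of `g = βδ₀ − a`: `∑_{k≤n} k!·g_k = β − ∑_{k≤n} k!·aₖ`. [folklore] -/
theorem sum_coeff_antiESeries_diffSeq (n : ℕ) :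
    ∑ k ∈ Finset.range (n + 1),
        PowerSeries.coeff k (antiESeries fun m => β * deltaZero m - chooseSeq s c m) =
      β - ∑ k ∈ Finset.range (n + 1), (k ! : ℂ) * chooseSeq s c k := by
  simp only [coeff_antiESeries, mul_sub, Finset.sum_sub_distrib]
  congr 1
  rw [Finset.sum_eq_single 0]
  · simp
  · intro k _ hk
    simp [deltaZero_of_ne_zero hk]
  · simp

/-- **The reduction** (what Conjecture 2 does in the proof of Corollary 1): assume Conjecture 2
(the antecedent of `FischlerRivoal2024_corollary1`, verbatim). If the `1`-sum at `z = 1` of the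
Э-function `∑ n! C(s,n) cⁿ zⁿ` (`s ∈ ℚ`, `c ∈ ℚ̄`) is an ALGEBRAIC number `β`, then `β − 𝔣(z·c)` is
an Э-function with vanishing sum at `1`, Conjecture 2 makes `(β − 𝔣(zc))/(z − 1)` an Э-function,
and its coefficients are explicit: the sequence `rₙ = (∑_{k≤n} k!·C(s,k)cᵏ − β)/n!` is then a
strict `E`-coefficient sequence. (The printed proof derives a contradiction from this via
Beukers' method — Proposition 4 / Theorem 3 —, whose engine, André's theorem on `E`-operators,
is not in the tree.) PROVED. [cite: FischlerRivoal2024, §5.1 (Proposition 4) and §5.2] -/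
theorem isStrictEFunction_residual_of_conj2
    (hC2 : ∀ (a : ℕ → ℂ), IsStrictEFunction a →
      ∀ θ : ℝ, θ ∈ Ioo (-(Real.pi / 2)) (Real.pi / 2) → IsAntiESum a θ 1 0 →
        ∃ g : PowerSeries ℂ, IsAntiEFunction g ∧ (PowerSeries.X - 1) * g = antiESeries a)
    (hc : IsAlgebraic ℚ c) (hβ : IsAlgebraic ℚ β) (hsum : IsBorelLaplaceSum (chooseSeq s c) 0 1 β) :
    IsStrictEFunction fun n =>
      ((∑ k ∈ Finset.range (n + 1), (k ! : ℂ) * chooseSeq s c k) - β) / n ! := by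
  have hg := isStrictEFunction_diffSeq s c β hc hβ
  have hd : (0 : ℝ) ∈ Ioo (-(Real.pi / 2)) (Real.pi / 2) :=
    ⟨by linarith [Real.pi_pos], by linarith [Real.pi_pos]⟩
  have h0 : IsAntiESum (fun n => β * deltaZero n - chooseSeq s c n) 0 1 0 := by
    rw [isAntiESum_zero_iff]
    have := (isBorelLaplaceSum_const_mul_deltaZero_one β hd).sub hsum
    rwa [sub_self] at this
  obtain ⟨g₁, hg₁, hmul⟩ := hC2 _ hg 0 hd h0
  rw [isAntiEFunction_iff] at hg₁
  convert hg₁ using 1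
  funext n
  rw [coeff_eq_neg_sum_of_X_sub_one_mul hmul, sum_coeff_antiESeries_diffSeq]
  ring

/-- `α^r` is algebraic for a positive real algebraic `α` and rational `r`. [folklore] -/
theorem isAlgebraic_rpow_ratCast {α : ℝ} (hα : IsAlgebraic ℚ α) (hpos : 0 < α) (r : ℚ) :
    IsAlgebraic ℚ (α ^ (r : ℝ)) := by
  have hden : 0 < r.den := r.den_pos
  refine IsAlgebraic.of_pow hden ?_
  rw [← Real.rpow_natCast, ← Real.rpow_mul hpos.le, show (r : ℝ) * (r.den : ℕ) = (r.num : ℤ) by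
    rw [show ((r.den : ℕ) : ℝ) = ((r.den : ℚ) : ℝ) by push_cast; rfl,
      show ((r.num : ℤ) : ℝ) = ((r.num : ℚ) : ℝ) by push_cast; rfl, ← Rat.cast_mul,
      Rat.mul_den_eq_num], Real.rpow_intCast]
  -- integer powers of algebraic numbers are algebraic
  rcases Int.natAbs_eq r.num with h | h <;> rw [h]
  · rw [zpow_natCast]; exact hα.pow _
  · rw [zpow_neg, zpow_natCast]; exact (hα.pow _).inv

/-- **Corollary 1 reduced to one explicit non-`E`-ness statement.** If, for every real algebraic
`α > 0`, every `s ∈ ℚ ∖ ℤ_{≥0}` and every real algebraic `β`, the sequence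
`rₙ = (∑_{k≤n} k!·C(s,k)α^{−k} − β)/n!` is NOT a strict `E`-coefficient sequence (which is what
André's theorem on `E`-operators yields in the printed proof, via Proposition 4), then the named
fact `FischlerRivoal2024_corollary1` holds: Conjecture 2 ⟹ `∫₀^∞ (t+α)^s e^{−t} dt ∉ ℚ̄`. The
hypothesis is explicit; nothing is discharged. PROVED (the reduction).
[cite: FischlerRivoal2024, §5.2] -/
theorem FischlerRivoal2024_corollary1_of_residual_not_isStrictEFunction
    (H : ∀ (α : ℝ), IsAlgebraic ℚ α → 0 < α → ∀ s : ℚ, (∀ n : ℕ, s ≠ n) →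
      ∀ β : ℝ, IsAlgebraic ℚ β →
        ¬ IsStrictEFunction fun n =>
          ((∑ k ∈ Finset.range (n + 1), (k ! : ℂ) * chooseSeq s ((α : ℂ)⁻¹) k) - (β : ℂ)) / n !) :
    FischlerRivoal2024_corollary1 := by
  intro hC2 α hα hpos s hs
  rw [Transcendental]
  intro hw
  set w : ℝ := ∫ t in Ioi (0 : ℝ), (t + α) ^ (s : ℝ) * Real.exp (-t) with hw_def
  set β : ℝ := α ^ (((-s : ℚ)) : ℝ) * w with hβ_def
  have hβalg : IsAlgebraic ℚ β := (isAlgebraic_rpow_ratCast hα hpos (-s)).mul hw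
  -- `β = ∫₀^∞ e^{−t}(1+t/α)^s dt` is the `1`-sum at `z = 1` of `∑ n! C(s,n) α^{−n} zⁿ`
  have hI : (∫ t in Ioi (0 : ℝ), Real.exp (-t) * (1 + t / α) ^ (s : ℝ)) = β := by
    rw [hβ_def, hw_def, integral_add_rpow_mul_exp_neg_eq _ hpos, ← mul_assoc,
      show (((-s : ℚ)) : ℝ) = -(s : ℝ) by push_cast; ring, Real.rpow_neg hpos.le,
      inv_mul_cancel₀ (Real.rpow_pos_of_pos hpos _).ne', one_mul]
  have hsum : IsBorelLaplaceSum (chooseSeq s ((α : ℂ)⁻¹)) 0 1 (β : ℂ) := by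
    have h1 := (isAntiESum_zero_iff _ _ _).1 (isAntiESum_chooseSeq_inv_one s hpos)
    rwa [integral_cexp_mul_one_add_div_cpow_eq_ofReal s hpos, hI] at h1
  have hαC : IsAlgebraic ℚ ((α : ℂ)⁻¹) := by
    have : IsAlgebraic ℚ (α : ℂ) := by simpa using hα.algebraMap (A := ℂ)
    exact this.inv
  have hβC : IsAlgebraic ℚ (β : ℂ) := by simpa using hβalg.algebraMap (A := ℂ)
  exact H α hα hpos s hs β hβalg (isStrictEFunction_residual_of_conj2 s _ _ hC2 hαC hβC hsum)

end Literature.NumberTheory.Transcendental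

end
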